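import Summits.CriticalPhenomena.PercolationContinuityZ3.Theorems.PercNearOneGluingNoHeavyLowerTailLonelyRelay
import Summits.CriticalPhenomena.PercolationContinuityZ3.Theorems.PercNearOneGluingAdditiveGluingKnThm2GoodEvents
import HarnessLib

/-!
# `NoHeavyLowerTail` (stmt-CriticalPhenomena-4575), line induct — the APPROXIMATE-CHAMPION lonely relay lemma (ACIL₁)

Support file (prover `prim-gen-induct`, gen 5; `--supports stmt-CriticalPhenomena-4575`).  No definitions, no
named facts, no sorries.

Setting: bond percolation with arbitrary edge probabilities on `Fin n` (`μ = prodBernoulli w`), a relay set `A`,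
and for a relay `x` the LONELINESS event `L_x = {x ↮ A ∖ x}` (at level `j = 1` this is `{|π(x)| ≤ 1}`), with
`I_x = μ(L_x)`; for a vertex `u`, `N_u = |{a ∈ A : u ↔ a}|`.

* `DisplacedChampion.approxChampion_lonelyRelay` — **ACIL₁**: if `c ∈ A` and `(1 − θ)·I_x ≤ I_c` for every other
  relay `x` (`0 ≤ θ ≤ 1`), then for EVERY vertex `u`:  `(1 − θ) · μ(N_u = 1, u ↮ c) ≤ μ(L_c, u ↮ c)`.
  At `θ = 0` (a champion `c`) this is the lonely relay lemma `P(N_u = 1) ≤ I_c` (`Theorems.lonelyRelay`,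
  Kozma–Nitzan Lemma 2) in its two-cluster form; for `θ > 0` it is strictly sharper than what the lonely relay
  lemma gives for an approximate champion (it keeps the term `μ(u ↔ c, L_c)` with coefficient `θ`:
  `(1−θ)·P(N_u = 1) + θ·μ(u ↔ c, L_c) ≤ I_c`).  Proof: Kozma–Nitzan's packing — terminal separation
  (BHK 2006 Thm 1.3, `stub_terminalSeparation`) `μ(u↔x, L_x)·μ(M) ≤ I_x·μ(u↔x, M)` with `M = {A pairwise separated}`,
  the events `{u ↔ x} ∩ M` being pairwise disjoint — with the weight `(1−θ)` on `x ≠ c` and `1` on `c`; the null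
  case `μ(M) = 0` by weight continuity exactly as in `…LonelyRelay`.
It is the first ingredient of the displaced-champion theorem `…CILDisplacedChampion.lean` (crux notes
BLOBQUOTIENT.md §23).  The level-`j ≥ 2` analogue of ACIL is FALSE (census in the crux notes): validity of a CIL
witness is multiplicatively stable in the championship margin at level one only.
-/

namespace Summit.CriticalPhenomena.PercolationContinuityZ3.Theorems

open scoped BigOperators Classical Topology
open MeasureTheory Set Filter
open Literature.Probability.LatticeModels (prodBernoulli)
open Literature.Probability.Percolation (openConn openGraph BondConfig
  BHK2006_clusterConditionalPositiveAssociation_holds)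

namespace DisplacedChampion

variable {n : ℕ}
/-- **Cover off `c`.**  If exactly one relay is joined to `u` and `u ↮ c`, then for some relay `x ≠ c`:
`u ↔ x` and `x` is joined to no other relay. [folklore] -/
theorem badOff_subset_biUnion (A : Finset (Fin n)) (u c : Fin n) :
    {ω : Set (Sym2 (Fin n)) | (A.filter fun a => ω ∈ openConn u a).card = 1} ∩ (openConn c u)ᶜ ⊆
      ⋃ x ∈ A.erase c, (openConn u x ∩ {ω | ∀ t ∈ A.erase x, ω ∉ openConn x t}) := by
  intro ω hω
  obtain ⟨hcard, hcu⟩ := hω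
  have h := lonelyRelay_subset_biUnion A u hcard
  obtain ⟨x, hxA, hx⟩ := Set.mem_iUnion₂.1 h
  refine Set.mem_iUnion₂.2 ⟨x, ?_, hx⟩
  refine Finset.mem_erase.2 ⟨?_, hxA⟩
  rintro rfl
  apply hcu
  rw [knThm2_openConn_comm]
  exact hx.1

/-- **ACIL₁ at positive separation mass, with slack.**  Under terminal separation (hypothesis `hTS`, discharged
below): if `c ∈ A`, `θ ≤ 1`, `(1−θ)·μ(L_x) ≤ μ(L_c) + ε` for all `x ∈ A ∖ c`, and `μ(M) > 0` for
`M = {A pairwise separated}`, then `(1−θ)·μ(N_u = 1, u ↮ c) ≤ μ(L_c, u ↮ c) + ε`.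
[cite: KozmaNitzan2024, Lemma 2 (p. 6) — mechanism; VandenbergHaggstromKahn2005, Thm. 1.3] -/
theorem approxChampion_lonelyRelay_of_pairSep_pos
    (hTS : ∀ (n : ℕ) (w : Sym2 (Fin n) → unitInterval) (T : Finset (Fin n)) (o a : Fin n),
      (prodBernoulli w).real (openConn o a ∩ {ω | ∀ t ∈ T, ω ∉ openConn a t}) *
        (prodBernoulli w).real ({ω | ∀ t ∈ T, ω ∉ openConn a t} ∩
            {ω | ∀ t ∈ T, ∀ t' ∈ T, t ≠ t' → ω ∉ openConn t t'}) ≤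
      (prodBernoulli w).real {ω | ∀ t ∈ T, ω ∉ openConn a t} *
        (prodBernoulli w).real (openConn o a ∩ ({ω | ∀ t ∈ T, ω ∉ openConn a t} ∩
              {ω | ∀ t ∈ T, ∀ t' ∈ T, t ≠ t' → ω ∉ openConn t t'})))
    (w : Sym2 (Fin n) → unitInterval) (A : Finset (Fin n)) (u c : Fin n) (hc : c ∈ A)
    (θ ε : ℝ) (hθ1 : θ ≤ 1) (hε : 0 ≤ ε)
    (hchamp : ∀ x ∈ A, x ≠ c →
      (1 - θ) * (prodBernoulli w).real {ω | ∀ t ∈ A.erase x, ω ∉ openConn x t} ≤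
        (prodBernoulli w).real {ω | ∀ t ∈ A.erase c, ω ∉ openConn c t} + ε)
    (hM : 0 < (prodBernoulli w).real
      {ω : Set (Sym2 (Fin n)) | ∀ x ∈ A, ∀ y ∈ A, x ≠ y → ω ∉ openConn x y}) :
    (1 - θ) * (prodBernoulli w).real
        ({ω : Set (Sym2 (Fin n)) | (A.filter fun a => ω ∈ openConn u a).card = 1} ∩ (openConn c u)ᶜ) ≤
      (prodBernoulli w).real ({ω | ∀ t ∈ A.erase c, ω ∉ openConn c t} ∩ (openConn c u)ᶜ) + ε := by
  set μ := prodBernoulli w with hμ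
  set M : Set (Set (Sym2 (Fin n))) := {ω | ∀ x ∈ A, ∀ y ∈ A, x ≠ y → ω ∉ openConn x y} with hMdef
  set L : Fin n → Set (Set (Sym2 (Fin n))) := fun x => {ω | ∀ t ∈ A.erase x, ω ∉ openConn x t} with hL
  set m : Fin n → ℝ := fun x => μ.real (openConn u x ∩ L x) with hm
  set q : Fin n → ℝ := fun x => μ.real (openConn u x ∩ M) with hq
  have h1θ : 0 ≤ 1 - θ := by linarith
  -- (1) cover and union bound
  have h1 : μ.real ({ω : Set (Sym2 (Fin n)) | (A.filter fun a => ω ∈ openConn u a).card = 1} ∩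
      (openConn c u)ᶜ) ≤ ∑ x ∈ A.erase c, m x :=
    (measureReal_mono (badOff_subset_biUnion A u c) (measure_ne_top _ _)).trans
      (measureReal_biUnion_finset_le (A.erase c) _)
  -- (2) terminal separation, term by term: m x * μ(M) ≤ μ(L x) * q x
  have h2 : ∀ x ∈ A, m x * μ.real M ≤ μ.real (L x) * q x := by
    intro x hx
    have key := hTS n w (A.erase x) u x
    rw [singleFinger_sep_inter_pairSep_eq A hx] at key
    exact key
  -- (3) disjointness of the events `{u ↔ x} ∩ M`
  have h3 : ∑ x ∈ A, q x ≤ μ.real M := by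
    have := measureReal_biUnion_finset (μ := μ)
      (singleFinger_pairwiseDisjoint_conn_inter_pairSep A A u subset_rfl)
      (fun a _ => MeasurableSet.of_discrete)
    rw [← this]
    exact measureReal_mono (Set.iUnion₂_subset fun a _ => Set.inter_subset_right)
  have h3' : ∑ x ∈ A.erase c, q x ≤ μ.real M - q c := by
    have := Finset.sum_erase_add A q hc
    linarith
  -- (4) the chain
  have hq0 : ∀ x, 0 ≤ q x := fun x => measureReal_nonneg
  have hsum : (1 - θ) * (∑ x ∈ A.erase c, m x) * μ.real M ≤
      (μ.real (L c) + ε) * (μ.real M - q c) := by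
    calc (1 - θ) * (∑ x ∈ A.erase c, m x) * μ.real M
        = ∑ x ∈ A.erase c, (1 - θ) * (m x * μ.real M) := by
          rw [Finset.mul_sum, Finset.sum_mul]
          refine Finset.sum_congr rfl fun x _ => by ring
      _ ≤ ∑ x ∈ A.erase c, (1 - θ) * (μ.real (L x) * q x) :=
          Finset.sum_le_sum fun x hx =>
            mul_le_mul_of_nonneg_left (h2 x (Finset.mem_of_mem_erase hx)) h1θ
      _ = ∑ x ∈ A.erase c, ((1 - θ) * μ.real (L x)) * q x :=
          Finset.sum_congr rfl fun x _ => by ring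
      _ ≤ ∑ x ∈ A.erase c, (μ.real (L c) + ε) * q x :=
          Finset.sum_le_sum fun x hx =>
            mul_le_mul_of_nonneg_right
              (hchamp x (Finset.mem_of_mem_erase hx) (Finset.ne_of_mem_erase hx)) (hq0 x)
      _ = (μ.real (L c) + ε) * ∑ x ∈ A.erase c, q x := (Finset.mul_sum _ _ _).symm
      _ ≤ (μ.real (L c) + ε) * (μ.real M - q c) :=
          mul_le_mul_of_nonneg_left h3' (by positivity)
  -- the `c`-term: μ(L c) (μ M - q c) ≤ μ M (μ(L c) - m c)
  have hcterm : μ.real (L c) * (μ.real M - q c) ≤ μ.real M * (μ.real (L c) - m c) := by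
    have := h2 c hc
    nlinarith
  -- μ(L c) - m c = μ(L c ∩ {u ↮ c})
  have hsplit : μ.real (L c) - m c = μ.real (L c ∩ (openConn c u)ᶜ) := by
    have hs := measureReal_inter_add_sdiff (μ := μ) (s := L c) (t := openConn c u) MeasurableSet.of_discrete
    have hm' : m c = μ.real (L c ∩ openConn c u) := by
      show μ.real (openConn u c ∩ L c) = μ.real (L c ∩ openConn c u)
      rw [Set.inter_comm, knThm2_openConn_comm]
    have hd : L c \ openConn c u = L c ∩ (openConn c u)ᶜ := Set.ext fun _ => Iff.rfl
    rw [hd] at hs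
    linarith
  have hqc_le : q c ≤ μ.real M := measureReal_mono Set.inter_subset_right
  have hfin : (1 - θ) * (∑ x ∈ A.erase c, m x) * μ.real M ≤
      μ.real M * μ.real (L c ∩ (openConn c u)ᶜ) + ε * μ.real M := by
    have hε' : ε * (μ.real M - q c) ≤ ε * μ.real M :=
      mul_le_mul_of_nonneg_left (by linarith [hq0 c]) hε
    calc (1 - θ) * (∑ x ∈ A.erase c, m x) * μ.real M
        ≤ (μ.real (L c) + ε) * (μ.real M - q c) := hsum
      _ = μ.real (L c) * (μ.real M - q c) + ε * (μ.real M - q c) := by ring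
      _ ≤ μ.real M * (μ.real (L c) - m c) + ε * μ.real M := add_le_add hcterm hε'
      _ = μ.real M * μ.real (L c ∩ (openConn c u)ᶜ) + ε * μ.real M := by rw [hsplit]
  -- divide by μ(M) > 0
  have hmul : ((1 - θ) * μ.real ({ω : Set (Sym2 (Fin n)) |
        (A.filter fun a => ω ∈ openConn u a).card = 1} ∩ (openConn c u)ᶜ)) * μ.real M ≤
      (μ.real (L c ∩ (openConn c u)ᶜ) + ε) * μ.real M := by
    calc ((1 - θ) * μ.real ({ω : Set (Sym2 (Fin n)) |
            (A.filter fun a => ω ∈ openConn u a).card = 1} ∩ (openConn c u)ᶜ)) * μ.real M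
        ≤ (1 - θ) * (∑ x ∈ A.erase c, m x) * μ.real M := by
          have := mul_le_mul_of_nonneg_left h1 h1θ
          exact mul_le_mul_of_nonneg_right this measureReal_nonneg
      _ ≤ μ.real M * μ.real (L c ∩ (openConn c u)ᶜ) + ε * μ.real M := hfin
      _ = (μ.real (L c ∩ (openConn c u)ᶜ) + ε) * μ.real M := by ring
  exact le_of_mul_le_mul_right hmul hM

/-- **ACIL₁, abstract form** (terminal separation and weight continuity as hypotheses, both discharged
below): `c ∈ A`, `0 ≤ θ ≤ 1`, `(1−θ)·I_x ≤ I_c` for `x ∈ A ∖ c` imply `(1−θ)·μ(N_u = 1, u ↮ c) ≤ μ(L_c, u ↮ c)`.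
[cite: KozmaNitzan2024, Lemma 2 (p. 6) — mechanism; VandenbergHaggstromKahn2005, Thm. 1.3] -/
theorem approxChampion_lonelyRelay_of_terminalSeparation
    (hTS : ∀ (n : ℕ) (w : Sym2 (Fin n) → unitInterval) (T : Finset (Fin n)) (o a : Fin n),
      (prodBernoulli w).real (openConn o a ∩ {ω | ∀ t ∈ T, ω ∉ openConn a t}) *
        (prodBernoulli w).real ({ω | ∀ t ∈ T, ω ∉ openConn a t} ∩
            {ω | ∀ t ∈ T, ∀ t' ∈ T, t ≠ t' → ω ∉ openConn t t'}) ≤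
      (prodBernoulli w).real {ω | ∀ t ∈ T, ω ∉ openConn a t} *
        (prodBernoulli w).real (openConn o a ∩ ({ω | ∀ t ∈ T, ω ∉ openConn a t} ∩
              {ω | ∀ t ∈ T, ∀ t' ∈ T, t ≠ t' → ω ∉ openConn t t'})))
    (hcont : ∀ (n : ℕ) (E : Set (BondConfig (Fin n))),
      Continuous fun w : Sym2 (Fin n) → unitInterval => (prodBernoulli w).real E)
    (w : Sym2 (Fin n) → unitInterval) (A : Finset (Fin n)) (u c : Fin n) (hc : c ∈ A)
    (θ : ℝ) (hθ0 : 0 ≤ θ) (hθ1 : θ ≤ 1)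
    (hchamp : ∀ x ∈ A, x ≠ c →
      (1 - θ) * (prodBernoulli w).real {ω | ∀ t ∈ A.erase x, ω ∉ openConn x t} ≤
        (prodBernoulli w).real {ω | ∀ t ∈ A.erase c, ω ∉ openConn c t}) :
    (1 - θ) * (prodBernoulli w).real
        ({ω : Set (Sym2 (Fin n)) | (A.filter fun a => ω ∈ openConn u a).card = 1} ∩ (openConn c u)ᶜ) ≤
      (prodBernoulli w).real ({ω | ∀ t ∈ A.erase c, ω ∉ openConn c t} ∩ (openConn c u)ᶜ) := by
  -- the scaled weights `w_k = (1 - 1/(k+1)) • w`, all `< 1`, converging to `w`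
  have hcmem : ∀ k : ℕ, ((1 : ℝ) - 1 / ((k : ℝ) + 1)) ∈ unitInterval := by
    intro k
    have hk : (0 : ℝ) < (k : ℝ) + 1 := Nat.cast_add_one_pos k
    have h1 : 1 / ((k : ℝ) + 1) ≤ 1 := by
      rw [div_le_one hk]; linarith [(Nat.cast_nonneg k : (0 : ℝ) ≤ k)]
    have h0 : 0 ≤ 1 / ((k : ℝ) + 1) := by positivity
    exact ⟨by linarith, by linarith⟩
  set wk : ℕ → Sym2 (Fin n) → unitInterval :=
    fun k e => ⟨(1 - 1 / ((k : ℝ) + 1)) * (w e : ℝ), unitInterval.mul_mem (hcmem k) (w e).2⟩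
    with hwk_def
  have hwk_lt : ∀ k e, ((wk k e : unitInterval) : ℝ) < 1 := by
    intro k e
    have hk : (0 : ℝ) < (k : ℝ) + 1 := Nat.cast_add_one_pos k
    have hc' : (1 : ℝ) - 1 / ((k : ℝ) + 1) < 1 := by
      have : 0 < 1 / ((k : ℝ) + 1) := by positivity
      linarith
    calc ((wk k e : unitInterval) : ℝ) = (1 - 1 / ((k : ℝ) + 1)) * (w e : ℝ) := rfl
      _ ≤ (1 - 1 / ((k : ℝ) + 1)) := mul_le_of_le_one_right (hcmem k).1 (w e).2.2
      _ < 1 := hc'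
  have hc_lim : Tendsto (fun k : ℕ => (1 : ℝ) - 1 / ((k : ℝ) + 1)) atTop (𝓝 1) := by
    simpa using tendsto_const_nhds.sub (tendsto_one_div_add_atTop_nhds_zero_nat (𝕜 := ℝ))
  have hwk_lim : Tendsto wk atTop (𝓝 w) := by
    refine tendsto_pi_nhds.2 fun e => ?_
    rw [tendsto_subtype_rng]
    have h := hc_lim.mul_const (w e : ℝ)
    rw [one_mul] at h
    exact h
  have hlimE : ∀ E : Set (Set (Sym2 (Fin n))),
      Tendsto (fun k => (prodBernoulli (wk k)).real E) atTop (𝓝 ((prodBernoulli w).real E)) :=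
    fun E => ((hcont n E).tendsto w).comp hwk_lim
  -- the error terms `δ k = ∑_{x ∈ A} |μ_{w_k}(L_x) - μ_w(L_x)| → 0`
  set δ : ℕ → ℝ := fun k => ∑ x ∈ A,
      |(prodBernoulli (wk k)).real {ω | ∀ t ∈ A.erase x, ω ∉ openConn x t} -
        (prodBernoulli w).real {ω | ∀ t ∈ A.erase x, ω ∉ openConn x t}|
    with hδ_def
  have hδ0 : ∀ k, 0 ≤ δ k := fun k => Finset.sum_nonneg fun a _ => abs_nonneg _
  have hδ_lim : Tendsto δ atTop (𝓝 0) := by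
    have h : ∀ x ∈ A, Tendsto (fun k =>
        |(prodBernoulli (wk k)).real {ω | ∀ t ∈ A.erase x, ω ∉ openConn x t} -
          (prodBernoulli w).real {ω | ∀ t ∈ A.erase x, ω ∉ openConn x t}|)
        atTop (𝓝 0) := by
      intro x _
      simpa using (tendsto_sub_nhds_zero_iff.2
        (hlimE {ω | ∀ t ∈ A.erase x, ω ∉ openConn x t})).abs
    simpa [hδ_def] using tendsto_finsetSum A h
  have hδx : ∀ k, ∀ x ∈ A, |(prodBernoulli (wk k)).real {ω | ∀ t ∈ A.erase x, ω ∉ openConn x t} -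
      (prodBernoulli w).real {ω | ∀ t ∈ A.erase x, ω ∉ openConn x t}| ≤ δ k := by
    intro k x hx
    exact Finset.single_le_sum (f := fun x =>
      |(prodBernoulli (wk k)).real {ω | ∀ t ∈ A.erase x, ω ∉ openConn x t} -
        (prodBernoulli w).real {ω | ∀ t ∈ A.erase x, ω ∉ openConn x t}|)
      (fun a _ => abs_nonneg _) hx
  -- the bound at each `k` with slack `2 δ k`
  have hk : ∀ k, (1 - θ) * (prodBernoulli (wk k)).real
      ({ω : Set (Sym2 (Fin n)) | (A.filter fun a => ω ∈ openConn u a).card = 1} ∩ (openConn c u)ᶜ) ≤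
      (prodBernoulli (wk k)).real ({ω | ∀ t ∈ A.erase c, ω ∉ openConn c t} ∩ (openConn c u)ᶜ) +
        2 * δ k := by
    intro k
    refine approxChampion_lonelyRelay_of_pairSep_pos hTS (wk k) A u c hc θ (2 * δ k) hθ1
      (by linarith [hδ0 k]) ?_ (singleFinger_pairSep_real_pos (wk k) (hwk_lt k) _)
    intro x hx hxc
    have h1 := hchamp x hx hxc
    have h2 := hδx k x hx
    have h3 := hδx k c hc
    have e2 := abs_le.1 h2
    have e3 := abs_le.1 h3
    have h1θ : 0 ≤ 1 - θ := by linarith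
    have : (1 - θ) * (prodBernoulli (wk k)).real {ω | ∀ t ∈ A.erase x, ω ∉ openConn x t} ≤
        (1 - θ) * ((prodBernoulli w).real {ω | ∀ t ∈ A.erase x, ω ∉ openConn x t} + δ k) :=
      mul_le_mul_of_nonneg_left (by linarith [e2.2]) h1θ
    nlinarith [e3.1, hδ0 k]
  -- pass to the limit `k → ∞`
  have hlimL : Tendsto (fun k => (1 - θ) * (prodBernoulli (wk k)).real
      ({ω : Set (Sym2 (Fin n)) | (A.filter fun a => ω ∈ openConn u a).card = 1} ∩ (openConn c u)ᶜ))
      atTop (𝓝 ((1 - θ) * (prodBernoulli w).real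
      ({ω : Set (Sym2 (Fin n)) | (A.filter fun a => ω ∈ openConn u a).card = 1} ∩ (openConn c u)ᶜ))) :=
    (hlimE _).const_mul _
  have hlimR : Tendsto (fun k => (prodBernoulli (wk k)).real
      ({ω | ∀ t ∈ A.erase c, ω ∉ openConn c t} ∩ (openConn c u)ᶜ) + 2 * δ k) atTop
      (𝓝 ((prodBernoulli w).real ({ω | ∀ t ∈ A.erase c, ω ∉ openConn c t} ∩ (openConn c u)ᶜ))) := by
    have := (hlimE ({ω | ∀ t ∈ A.erase c, ω ∉ openConn c t} ∩ (openConn c u)ᶜ)).add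
      (hδ_lim.const_mul 2)
    simpa using this
  exact le_of_tendsto_of_tendsto' hlimL hlimR hk

/-- **THE APPROXIMATE-CHAMPION LONELY RELAY LEMMA (ACIL₁)** (all `|A|`, unconditional).  For bond percolation
with arbitrary edge probabilities on `Fin n`, a relay set `A`, a relay `c ∈ A`, any vertex `u` and `0 ≤ θ ≤ 1`:
if `(1−θ)·μ(x ↮ A∖x) ≤ μ(c ↮ A∖c)` for every other relay `x`, then
`(1−θ) · μ(N_u = 1, u ↮ c) ≤ μ(c ↮ A∖c, u ↮ c)`, where `N_u = |{a ∈ A : u ↔ a}|`.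
For `θ = 0` this is the lonely relay lemma (Kozma–Nitzan Lemma 2) in two-cluster form. -/
theorem approxChampion_lonelyRelay (w : Sym2 (Fin n) → unitInterval) (A : Finset (Fin n)) (u c : Fin n)
    (hc : c ∈ A) (θ : ℝ) (hθ0 : 0 ≤ θ) (hθ1 : θ ≤ 1)
    (hchamp : ∀ x ∈ A, x ≠ c →
      (1 - θ) * (prodBernoulli w).real {ω | ∀ t ∈ A.erase x, ω ∉ openConn x t} ≤
        (prodBernoulli w).real {ω | ∀ t ∈ A.erase c, ω ∉ openConn c t}) :
    (1 - θ) * (prodBernoulli w).real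
        ({ω : Set (Sym2 (Fin n)) | (A.filter fun a => ω ∈ openConn u a).card = 1} ∩ (openConn c u)ᶜ) ≤
      (prodBernoulli w).real ({ω | ∀ t ∈ A.erase c, ω ∉ openConn c t} ∩ (openConn c u)ᶜ) := by
  refine approxChampion_lonelyRelay_of_terminalSeparation (stub_terminalSeparation ?_)
    stub_weightContinuity w A u c hc θ hθ0 hθ1 hchamp
  intro n w s X F G hF hG hs
  exact BHK2006_clusterConditionalPositiveAssociation_holds (Fin n) w s X F G hF hG hs
end DisplacedChampion

end Summit.CriticalPhenomena.PercolationContinuityZ3.Theorems
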